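import Mathlib.Tactic.IntervalCases
import Summits.CriticalPhenomena.PercolationContinuityZ3.Theorems.PercNearOneGluingNoHeavyLowerTailSahiSlotPatternSignMinus
import Summits.CriticalPhenomena.PercolationContinuityZ3.Theorems.PercNearOneGluingNoHeavyLowerTailSahiSlotPatternThree
import Summits.CriticalPhenomena.PercolationContinuityZ3.Theorems.PercNearOneGluingNoHeavyLowerTailSahiSlotPatternTwo

/-!
# SIGN(3,4) is unconditional

Support file (lane `prim-masterthm-p3`, generation 18; `--supports stmt-CriticalPhenomena-4575`).  Pure proof, no definitions, no
`sorry`; COMPUTATIONAL closure: through `slotPatternPos_three_three` it rests on cell `prim-sahi`'s `native_decide` certificate of the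
`[3]^3` pattern inequality (`SahiGrid3`), exactly like `…SahiSlotPatternThree`.

On the first open cell `[4]^3` the C-slot SIGN law holds outright: for up-sets `U_1, U_2, U_3 ⊆ [4]^3` the slot profile
`P_y = patternForm 3 4 (1_{{y}}, 1_{U_1}, 1_{U_2}, 1_{U_3})` is `≥ 0` at every `y ∈ U_1 ∩ U_2 ∩ U_3` (`patternForm_single_nonneg`, std
axioms) and `≤ 0` at every other `y` (this file: the lower cells `(3,1)`, `(3,2)`, `(3,3)` feed `patternForm_single_nonpos`).  The open
inequality `SlotPatternPos 3 4` is the statement that the negative mass never wins along an up-set: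
`Σ_{y ∈ U_4} P_y ≥ 0`. [this work]
-/

namespace Summit.CriticalPhenomena.PercolationContinuityZ3.Theorems

open Finset Function
open Literature.Combinatorics.Sahi2008

namespace SahiSlot

/-- **SIGN(3,4) IS UNCONDITIONAL**: on `[4]^3` the slot profile of three up-sets is `≤ 0` at every point outside one of them
(the cells `(3,1), (3,2), (3,3)` are kernel theorems), and `≥ 0` at every point of the intersection (`patternForm_single_nonneg`).
[this work] -/
theorem patternForm_single_nonpos_three_four (y : Q 3 4) (U : Fin 3 → Finset (Q 3 4))
    (hU : ∀ j, IsUpperSet (U j : Set (Q 3 4))) (j₀ : Fin 3) (hy : y ∉ U j₀) :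
    patternForm 3 4 (Fin.cons (setInd {y}) (fun j => setInd (U j))) ≤ 0 := by
  refine patternForm_single_nonpos (fun k hk1 hk3 => ?_) y U hU j₀ hy
  interval_cases k
  · exact slotPatternPos_one 3
  · exact slotPatternPos_two 3
  · exact slotPatternPos_three_three


end SahiSlot

end Summit.CriticalPhenomena.PercolationContinuityZ3.Theorems
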